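import Literature.IUT.LogVolume.TensorPacketUnramified
import Literature.IUT.LogVolume.PacketDifferent
import Literature.IUT.LogVolume.LogRadius
import HarnessLib

/-!
# The log-shell lattice of an absolutely unramified tensor packet IS its integral structure
# ([IUTchIV] Prop. 1.2 (i), (iv) / Thm. 1.10 Step (vi), read on `V = ⊗_{ℚ_p} k_i`)

Mochizuki, *Inter-universal Teichmüller theory IV* (RIMS ms Apr. 2020 = PRIMS **57** (2021)), Prop. 1.2
(i), kurims p. 10: "`p^{a_i}·R_i ⊆ log_p(R_i^×) ⊆ p^{−b_i}·R_i` … the "`⊆`'s" are equalities when `p > 2` and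
`e_i ≤ p − 2`", and "if `p > 2` and `e_i = 1` … we have `d_I = 0`, `a_I = −b_I ∈ ℤ`" (proof of (iv), p. 11);
Prop. 1.1, p. 9: "`p^{d_{I*}}·(R_I)^∼ ⊆ R_I ⊆ (R_I)^∼`"; Thm. 1.10 Step (vi), p. 29: "the “container of possible
images” is precisely equal to the tensor product of log-shells under consideration … [whose log-volume is]
“`0`” … the final equality of Proposition 1.4, (iv)".

THIS FILE makes the SET-THEORETIC identity behind Step (vi) explicit on the cell's tensor packet
`V = PacketAlgebra p k` (abc-iut-S1), for `p > 2` and all `e_i = 1` (and `|I| ≥ 2`, the standing hypothesis):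
* `integerPacket_eq_normalizedPacket_of_unramified` — `R_I = (R_I)^∼` (Prop. 1.1 with trivial differents,
  abc-iut-S5's `prop11_holds` + abc-iut-S6's `different_eq_top_of_absRamificationIdx_eq_one`);
* `mem_logUnits_iff_norm_le_of_unramified` — per factor `log_p(R_i^×) = p·R_i` (abc-iut-S1's `prop12iEq_holds`, `a_i = 1`);
* `coe_logPacket_eq_smul_integerPacket` — `log_p(R_I^×) = p^{|I|}·R_I` as subsets of `V`
  (`⊗(p·y_i) = p^{|I|}·⊗y_i`);
* `smul_coe_integerPacket_of_norm_eq_one` — `ℤ_p^×`-scalars fix `R_I`;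
* **`inv_two_p_pow_smul_logPacket_eq_normalizedPacket`** — `((2p)^{|I|})⁻¹·log_p(R_I^×) = (R_I)^∼`: Dupuy–Hilado's
  log-shell lattice `I_{v⃗} = (2p)^{−(j+1)}·⊗ log(O^×_{v̲_i})` (§4.7) EQUALS the integral structure `O_{v⃗}` at an
  odd prime where every factor is absolutely unramified — the hypothesis `hshell` of
  `Summit.ABC.IUTFork.DHData.hullSupportedOn_of_shell` (`LDHHullSupport.lean`) for the real packet
  (abc-iut-c312-3's `realPrimePacket_shell = logShell := shellScalar • logPacket`, `shellScalar = ((2p)^{|I|})⁻¹`).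
Proof-only; no definitions. [cite: Mochizuki2012, IUTchIV Prop. 1.2 (i) p. 10, Prop. 1.1 p. 9, Thm 1.10 proof
Step (vi) p. 29] [cite: DupuyHilado2025, §4.7] Nothing here takes a side on [IUTchIII] Cor. 3.12.
-/

noncomputable section

open Set
open scoped Pointwise TensorProduct NormedField

namespace Literature.IUT.LogVolume

variable (p : ℕ) [Fact p.Prime]
variable {I : Type} [Fintype I] [DecidableEq I]
variable (k : I → Type) [∀ i, NontriviallyNormedField (k i)] [∀ i, NormedAlgebra ℚ_[p] (k i)]
  [∀ i, IsUltrametricDist (k i)] [∀ i, ProperSpace (k i)]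

/-! ## `R_I = (R_I)^∼` when every factor is absolutely unramified -/

/-- **`R_I = (R_I)^∼`** for `|I| ≥ 2` and all `e_i = 1`: the differents are trivial, so Prop. 1.1's
"`p^{d_{I*}}·(R_I)^∼ ⊆ R_I`" reads `(R_I)^∼ ⊆ R_I` (take every generator `δ_i = 1`).
[cite: Mochizuki2012, IUTchIV Prop. 1.1 p. 9] -/
theorem integerPacket_eq_normalizedPacket_of_unramified (hI : 2 ≤ Fintype.card I)
    (he : ∀ i, absRamificationIdx p (k i) = 1) : integerPacket p k = normalizedPacket p k := by
  haveI : Nonempty I := Fintype.card_pos_iff.mp (by omega)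
  obtain ⟨star⟩ := ‹Nonempty I›
  have h11 := prop11_holds p k hI star (fun _ => 1)
    (fun i _ => by rw [different_eq_top_of_absRamificationIdx_eq_one p (k i) (he i)]; simp) rfl
  refine le_antisymm h11.2 fun x hx => ?_
  have h := h11.1 x hx
  have h1 : purePacket p k (fun i => ((1 : Valued.integer (k i)) : k i)) = 1 := by
    have : (fun i => ((1 : Valued.integer (k i)) : k i)) = 1 := funext fun _ => rfl
    rw [this, purePacket_one]
  rwa [h1, one_mul] at h

/-! ## `log_p(R_i^×) = p·R_i` per factor, and `log_p(R_I^×) = p^{|I|}·R_I` -/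

section OneFactor

variable {K : Type} [NontriviallyNormedField K] [NormedAlgebra ℚ_[p] K] [IsUltrametricDist K]
  [ProperSpace K]

/-- **`log_p(R^×) = p·R`** for `p > 2`, `e = 1`: `z ∈ log_p(R^×) ↔ ‖z‖ ≤ p⁻¹` (Prop. 1.2 (i) with equality,
`a = 1/e = 1`). [cite: Mochizuki2012, IUTchIV Prop. 1.2 (i) p. 10] -/
theorem mem_logUnits_iff_norm_le_of_unramified (hp : 2 < p) (he : absRamificationIdx p K = 1) (z : K) :
    z ∈ logUnits K ↔ ‖z‖ ≤ (p : ℝ)⁻¹ := by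
  have hEq := (prop12iEq_holds p K hp (by rw [he]; omega)).1
  rw [he, logRadiusA_eq hp le_rfl (by omega)] at hEq
  rw [← hEq, mem_pBall_iff]
  norm_num [Real.rpow_neg_one]

/-- For `e = 1`, `p > 2`: every `z ∈ log_p(R^×)` is `p·y` with `y` integral. [cite: Mochizuki2012, IUTchIV Prop. 1.2 (i) p. 10] -/
theorem exists_eq_p_smul_of_mem_logUnits (hp : 2 < p) (he : absRamificationIdx p K = 1) {z : K}
    (hz : z ∈ logUnits K) : ∃ y : K, ‖y‖ ≤ 1 ∧ z = (p : ℚ_[p]) • y := by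
  have hp0 : (p : ℝ) ≠ 0 := by exact_mod_cast (Fact.out : p.Prime).ne_zero
  have hpQ : (p : ℚ_[p]) ≠ 0 := by exact_mod_cast (Fact.out : p.Prime).ne_zero
  refine ⟨(p : ℚ_[p])⁻¹ • z, ?_, by rw [smul_smul, mul_inv_cancel₀ hpQ, one_smul]⟩
  rw [norm_smul, norm_inv, Padic.norm_p]
  have h := (mem_logUnits_iff_norm_le_of_unramified p hp he z).mp hz
  rw [inv_inv]
  calc (p : ℝ) * ‖z‖ ≤ p * (p : ℝ)⁻¹ := by gcongr
    _ = 1 := mul_inv_cancel₀ hp0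

/-- For `e = 1`, `p > 2`: `p·y ∈ log_p(R^×)` for every integral `y`. [cite: Mochizuki2012, IUTchIV Prop. 1.2 (i) p. 10] -/
theorem p_smul_mem_logUnits (hp : 2 < p) (he : absRamificationIdx p K = 1) {y : K} (hy : ‖y‖ ≤ 1) :
    (p : ℚ_[p]) • y ∈ logUnits K := by
  rw [mem_logUnits_iff_norm_le_of_unramified p hp he, norm_smul, Padic.norm_p]
  have hp0 : (0 : ℝ) < (p : ℝ)⁻¹ := by
    have : (0 : ℝ) < p := by exact_mod_cast (Fact.out : p.Prime).pos
    positivity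
  calc (p : ℝ)⁻¹ * ‖y‖ ≤ (p : ℝ)⁻¹ * 1 := by gcongr
    _ = (p : ℝ)⁻¹ := mul_one _

end OneFactor

omit [DecidableEq I] in
/-- **`log_p(R_I^×) = p^{|I|}·R_I`** (as subsets of `V`) for `p > 2` and all `e_i = 1`: a pure tensor of
elements of the `log_p(R_i^×) = p·R_i` is `⊗(p·y_i) = p^{|I|}·⊗y_i` with `⊗y_i ∈ R_I`, and conversely.
[cite: Mochizuki2012, IUTchIV Prop. 1.2 (i) p. 10] -/
theorem coe_logPacket_eq_smul_integerPacket (hp : 2 < p) (he : ∀ i, absRamificationIdx p (k i) = 1) :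
    (logPacket p k : Set (PacketAlgebra p k)) =
      ((p : ℚ_[p]) ^ Fintype.card I) • (integerPacket p k : Set (PacketAlgebra p k)) := by
  set c : ℚ_[p] := (p : ℚ_[p]) ^ Fintype.card I with hc
  -- the target as an additive subgroup: the image of `R_I` under `x ↦ c • x`
  let f : PacketAlgebra p k →+ PacketAlgebra p k := DistribSMul.toAddMonoidHom (PacketAlgebra p k) c
  have hcoe : ((integerPacket p k).toAddSubgroup.map f : Set (PacketAlgebra p k)) =
      c • (integerPacket p k : Set (PacketAlgebra p k)) := by
    rw [AddSubgroup.coe_map]; rfl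
  refine le_antisymm ?_ ?_
  · -- `⊆`: generators `⊗z`, `z_i ∈ log_p(R_i^×)`, lie in `c·R_I`
    rw [← hcoe]
    refine (AddSubgroup.closure_le _).mpr ?_
    rintro _ ⟨z, hz, rfl⟩
    choose y hy hzy using fun i => exists_eq_p_smul_of_mem_logUnits p hp (he i) (hz i)
    have hz' : z = fun i => (p : ℚ_[p]) • y i := funext hzy
    rw [hcoe, hz', purePacket_smul, Finset.prod_const, Finset.card_univ]
    exact Set.smul_mem_smul_set (purePacket_mem_integerPacket p k hy)
  · -- `⊇`: for `x ∈ R_I`, `c·x ∈ log_p(R_I^×)` — by induction over the additive generators of `R_I`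
    rintro _ ⟨x, hx, rfl⟩
    change c • x ∈ (logPacket p k : Set (PacketAlgebra p k))
    refine integerPacket_induction p k (C := fun t => c • t ∈ (logPacket p k : Set (PacketAlgebra p k)))
      ?_ ?_ ?_ ?_ hx
    · intro y hy
      have h : c • purePacket p k y = purePacket p k (fun i => (p : ℚ_[p]) • y i) := by
        rw [purePacket_smul, Finset.prod_const, Finset.card_univ]
      rw [h]
      exact AddSubgroup.subset_closure ⟨_, fun i => p_smul_mem_logUnits p hp (he i) (hy i), rfl⟩
    · rw [smul_zero]; exact (logPacket p k).zero_mem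
    · intro a b ha hb; rw [smul_add]; exact (logPacket p k).add_mem ha hb
    · intro a ha; rw [smul_neg]; exact (logPacket p k).neg_mem ha

omit [Fintype I] [∀ i, IsUltrametricDist (k i)] [∀ i, ProperSpace (k i)] in
/-- `ℤ_p^×`-scalars fix `R_I`: for `‖r‖ = 1`, `r·R_I = R_I` (as subsets of `V`).
[cite: Mochizuki2012, IUTchIV Prop. 1.1 p. 9] -/
theorem smul_coe_integerPacket_of_norm_eq_one [Nonempty I] {r : ℚ_[p]} (hr : ‖r‖ = 1) :
    r • (integerPacket p k : Set (PacketAlgebra p k)) = integerPacket p k := by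
  have hr0 : r ≠ 0 := norm_pos_iff.mp (by rw [hr]; exact one_pos)
  refine le_antisymm ?_ fun x hx => ?_
  · rintro _ ⟨x, hx, rfl⟩
    exact smul_mem_integerPacket p k hr.le hx
  · refine ⟨r⁻¹ • x, smul_mem_integerPacket p k (by rw [norm_inv, hr, inv_one]) hx, ?_⟩
    change r • (r⁻¹ • x) = x
    rw [smul_smul, mul_inv_cancel₀ hr0, one_smul]

/-- `‖2‖_p = 1` for an odd prime `p`. [folklore] -/
private theorem norm_two_eq_one (hp : 2 < p) : ‖(2 : ℚ_[p])‖ = 1 := by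
  have h1 : ‖((2 : ℤ) : ℚ_[p])‖ ≤ 1 := Padic.norm_int_le_one 2
  have h2 : ¬ ‖((2 : ℤ) : ℚ_[p])‖ < 1 := by
    rw [Padic.norm_intCast_lt_one_iff]
    intro h
    have : (p : ℤ) ≤ 2 := Int.le_of_dvd (by norm_num) h
    omega
  push_cast at h1 h2
  exact le_antisymm h1 (not_lt.mp h2)

/-- **The log-shell lattice is the integral structure at a good prime**: for `p > 2`, all `e_i = 1` and
`|I| ≥ 2`, `((2p)^{|I|})⁻¹·log_p(R_I^×) = (R_I)^∼` — Dupuy–Hilado's `I_{v⃗} = (2p)^{−(j+1)}·⊗_i log(O^×_{v̲_i})`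
equals `O_{v⃗}` (the tensor product of log-shells IS the container of Step (vi), of log-volume `0`).
[cite: DupuyHilado2025, §4.7] -/
theorem inv_two_p_pow_smul_logPacket_eq_normalizedPacket (hI : 2 ≤ Fintype.card I) (hp : 2 < p)
    (he : ∀ i, absRamificationIdx p (k i) = 1) :
    ((2 * p : ℚ_[p]) ^ Fintype.card I)⁻¹ • (logPacket p k : Set (PacketAlgebra p k)) =
      (normalizedPacket p k : Set (PacketAlgebra p k)) := by
  haveI : Nonempty I := Fintype.card_pos_iff.mp (by omega)
  have hpQ : (p : ℚ_[p]) ≠ 0 := by exact_mod_cast (Fact.out : p.Prime).ne_zero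
  rw [coe_logPacket_eq_smul_integerPacket p k hp he, smul_smul,
    ← integerPacket_eq_normalizedPacket_of_unramified p k hI he]
  have hscal : ((2 * p : ℚ_[p]) ^ Fintype.card I)⁻¹ * (p : ℚ_[p]) ^ Fintype.card I =
      ((2 : ℚ_[p]) ^ Fintype.card I)⁻¹ := by
    rw [mul_pow, mul_inv, mul_assoc, inv_mul_cancel₀ (pow_ne_zero _ hpQ), mul_one]
  rw [hscal]
  refine smul_coe_integerPacket_of_norm_eq_one p k ?_
  rw [norm_inv, norm_pow, norm_two_eq_one p hp, one_pow, inv_one]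

end Literature.IUT.LogVolume

end
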